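import Summits.BirchSwinnertonDyer.BirchSwinnertonDyer.Theses.ErratumRoadFive
import Literature.NumberTheory.EllipticCurves.Kato2004.AdmissibleZetaClassRealisability
import Literature.NumberTheory.EllipticCurves.MordellWeilTheoremProofs
import Literature.NumberTheory.EllipticCurves.TateModuleContinuityProofs
import Literature.NumberTheory.EllipticCurves.LeadingTerm
import Literature.NumberTheory.EllipticCurves.Rank1Residual.Typed.Basic
import HarnessLib

/-!
# Line `kato_Fframe` — STAGE 1 skeleton of the door «kato-bottom-layer-exczero» on
# `ErratumRoadFive.EulerHalfNotRamNoInertSetAtFive` (stmt-BirchSwinnertonDyer-19715) — rev 3.1 CANDIDATE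

DRAFT TURNKEY (planner-bsd-idea-9, lens = complete). rev 1 g35 (3f0a913fb0763e68, critic V253 PASS), rev 2 g36
(c6ad67b45cb26edf, critic V259 PASS, pen farm check GREEN) stand at `Lines/kato_Fframe.lean`; THIS file is the
rev-3 CANDIDATE published at a SEPARATE path (`Lines/kato_Fframe_r3.lean`) so that the object priced for GATE B
(rev 2) is untouched — it is a drop-in replacement (same namespace, same composition name) that the route pen /
LEAD may key INSTEAD of rev 2, at GATE B or later. Published by `ledger crux write` ONLY; NOT registered (W-79:
the line of record on 19715 stays `Lines/birth.lean` v17). Nothing here is a route item; no summit statement,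
crux or stub is proved by this file; BSD is proved for no curve. rev 3.1 (g38, 2026-08-30; SAME path, statements
byte-identical to rev 3 = 24e20d3f06443750, docstrings only): critic V265 W1 answered — step (1) of LEMMA D_p is
rewritten as (1′)+(2′) with a PROOF (LEMMA UN-germ below); W2/W3 answered in words (PRINT vs LEMMA layers; `m′`).

## What rev 3 changes (one lever; crux idea card `Ideas/univnorm-defect-at-p.md`)

rev 2 cut the door at «`p` split ∧ `E(ℚ_p)[p] = 0`» because on J3 (`p` split, `E(ℚ_p)[p] ≠ 0`; 47 of the 334
door-type census pairs, all with `m := ord_p #E(ℚ_p)[p^∞] = 1`) the chain S1 ∧ S2′ ∧ S3 is exactly `m` short: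
it needs Kato's Kolyvagin system to be divisible by `p^m` in `KS(T_pE, F_can)` — «the Tamagawa factor AT p of
the strict Selmer structure», in print only for `p ∤ N` and only GIVEN Kato's main conjecture (Castella–Sano
2026 (eq:M-kato)). rev 3 books that factor UNCONDITIONALLY by running Büyükboduk's own one-prime mechanism
(J. Number Theory 2009 = arXiv:0710.3858, Prop. 2.7 + Cor. 2.8 + Thm. 3.1/3.2) AT THE PRIME `ℓ = p` with the
UNIVERSAL-NORM local condition in place of his unramified one:

LEMMA D_p (defect at `p`; print-assembled, each step cited, the statement itself NOT in print — Büyükboduk,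
«Λ-adic Kolyvagin systems», IMRN 2011 = arXiv:0706.0377, Remark 10 (arXiv p. 20): «we are unable to formulate a
precise conjecture for the size of the cokernel [of `KS(T⊗Λ) → KS(T)`] … we expect it related to
`|(T^*)^{G_{ℚ_p}}|` … one can show `p ∣ #coker` if it is `> 1`»). Let `p ≥ 5`, `ρ_{E,p}` onto `GL₂(ℤ_p)`
(Serre, from `ρ̄` onto), `T = T_pE`, `𝒫` the Kolyvagin primes, `m = ord_p #E(ℚ_p)[p^∞]`. Then
`κ^{Kato} ∈ p^m · KS(T, F_can, 𝒫)`, i.e. `∂^{(∞)}(κ^{Kato}) ≥ m`. Steps (rev 3.1: (1)–(2) REWRITTEN as (1′)–(2′)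
after critic V265 W1; proof of (1′) in § «rev 3.1» below): (1′) [LEMMA UN-germ — ours, elementary] let
`U := im(H¹_Iw(ℚ_p,T) = H¹(ℚ_p,T⊗Λ) → H¹(ℚ_p,T))` (universal norms of the local cyclotomic tower; `U = cores
H¹(ℚ_{p,b₀},T)` for some finite layer `b₀`) and `p^{m′}` := the exponent of `E(ℚ_{p,b₀})[p^∞]` (`m′ = m` at split
multiplicative `p`); then for every `k ≥ 1`, every `j ≥ max(k + m′, b₀ + 1)` and every `n ∈ N(𝒫 ∩ 𝒫_j)`:
`loc_p(κ^{Kato}_n mod p^k) ∈ im(U → H¹(ℚ_p, T/p^kT))` — the PROPAGATED universal-norm condition holds AT THE GERM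
LEVEL. It is NOT claimed at full level `T/I_nT`: there the obstruction `H²(ℚ_p,T)[I_n] ≅ (E(ℚ_p)[p^∞])^∨[I_n] ≠ 0`
(`m ≥ 1`) is real, and it is exactly why Mazur–Rubin Thm. 3.2.4 maps `ES(T) → KS̄(T, F_can, 𝒫)` (the GENERALISED
module) with no hypothesis at `p` but into the naive `KS(T, F_can, 𝒫)` only «if we further assume that
`H⁰(ℚ_p, E[p^∞])` is a divisible `ℤ_p`-module» [Kim AJM Thm. 2.1 = MR Thm. 3.2.4, arXiv:2203.12159 p. 12]. (2′) Hence
the level-`k` germ of `κ^{Kato}` in `KS̄(T, F_can, 𝒫) = lim_k lim_j KS(T/p^k, F_can, 𝒫 ∩ 𝒫_j)` [MR Def. 3.1.6] is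
represented by `(κ^{Kato}_n mod p^k)_{n ∈ N(𝒫∩𝒫_j)} ∈ KS(T/p^k, F_univ, 𝒫 ∩ 𝒫_j)` with `F_univ` := (`U` at `p`,
`F_can` elsewhere) — the conclusion one would read off Mazur–Rubin's `F_Λ` by transitivity of propagation (the
Selmer structure `F_Λ` INDUCES on the quotients of `T⊗Λ` is the propagated one and «coincides with `F_can` if (ℍ.T)
and (ℍ.nE) hold» — Büyükboduk 2011 p. 24; specialisation `κ^{Kato} := image of κ^{Kato,∞}`: MR Thm. 5.3.3, Kim AJM
Thm. 4.3 (p. 20), Büyükboduk 2011 §4.1 (p. 22)), now with the at-`p` membership PROVED instead of read off a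
convention; and `KS̄(T, F_can, 𝒫) ≅ KS(T, F_can, 𝒫)` canonically at core rank one [Büyükboduk 2009 Thm. 2.4 (ii) =
MR Prop. 5.2.9 + Thm. 5.2.10, arXiv:0710.3858 p. 8, and p. 10], so nothing is lost by working with germs; (3)
`H¹(ℚ_p,T)/U ≅ H²(ℚ_p,T⊗Λ)[γ−1] ≅ (M_Γ)^∨`, `M := E(ℚ_{p,∞})[p^∞]` over the local cyclotomic `ℤ_p`-tower
[Büyükboduk 2011 Prop. 12 (proof, p. 24) + Tate local duality]; `M` is finite (Imai) and cyclic (`μ_p ⊄ ℚ_{p,∞}`),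
so `H¹(ℚ_p,T)/U ≅ ℤ/p^m` (`#M_Γ = #M^Γ = #E(ℚ_p)[p^∞]`); (4) for `n ≤ m`, `H¹(ℚ_p,T)/H¹_{F_can}(ℚ_p,T) = 0` is
torsion-free and `H¹_{F_can}(ℚ_p,T/pⁿ)/H¹_{F_univ}(ℚ_p,T/pⁿ) ≅ (ℤ/p^m)/pⁿ = ℤ/pⁿ` is free of rank one, so `F_univ`
is cartesian on `Quot(T/pⁿ)` and of core rank `0` [Büyükboduk 2009 Prop. 2.7, Cor. 2.8 — stated for ANY prime
`ℓ ∈ Σ(F)`, here `ℓ = p`]: `KS(T/pⁿ, F_univ, 𝒫 ∩ 𝒫_j) = 0` for every `j ≥ n` (Büyükboduk 2009 Thm. 2.3 (i) = MR;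
his H5 «`𝒫_t ⊂ 𝒫 ⊂ 𝒫_1`» holds for `𝒫 ∩ 𝒫_j ⊇ 𝒫_{max(t,j)}`, p. 7); (5) hence the image of `κ^{Kato}` in
`KS(T/p^m, F_can, 𝒫_m) ≅ ℤ/p^m` (free of rank one, generated by the image of the primitive generator `κ^E`;
MR Thm. 5.2.10 / Büyükboduk 2009 Thm. 2.3–2.4) vanishes: `κ^{Kato} = p^α κ^E` with `α ≥ m`. ∎ The phenomenon —
specialisation of Λ-adic systems is NOT surjective in the exceptional-zero / anomalous case — is acknowledged
and AVOIDED by hypothesis in print (Kim–Kim–Sun, Selecta 2020 = arXiv:1709.05780 Remark 2.1; Kim AJM Thm. 1.11,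
Thm. 6.1 = Büyükboduk's rigidity theorem under `E(ℚ_p)[p] = 0`); D_p quantifies it. At a split multiplicative `p`,
`E(ℚ_p)[p] ≠ 0 ⟺ q_E ∈ (ℚ_pˣ)^p ⟺ p ∣ ord_p(q_E) ∧ u_q ∈ (ℤ_pˣ)^p` (Tate; Kim AJM Prop. 3.1 prints the first
conjunct) and `m = min(ord_p c_p, ord_p log_p u_q − 1)`.

rev 3.1 — PROOF OF (1′) (LEMMA UN-germ; answers critic V265 W1 «every derivative class must satisfy the PROPAGATED
universal-norm condition, not merely lie in `im H¹(ℚ_p, T⊗Λ/I_n)`; the two differ by `H²_Iw(ℚ_p,T)[I_n] ≠ 0` when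
`m ≥ 1`»). (a) DERIVATIVE CLASSES OVER THE LAYER `ℚ_{b₀}`: for `n ∈ N(𝒫_j)` with `j > b₀` every `ℓ ∣ n` splits
completely in `ℚ_{b₀}` (`ℓ ≡ 1 mod p^j`); Kato's classes `z_{ℚ_{b₀}(μ_n)} ∈ H¹(ℚ_{b₀}(μ_n), T)` exist with EXACT norm
relations in the `p`-direction (`Sp`-imprimitive normalisation, Kim AJM p. 12) and `E(ℚ^{ab})[p] = 0` (`ρ̄` onto), so
the descended derivative class `κ_{n,b₀} ∈ H¹(ℚ_{b₀}, T/I_nT)`, `res κ_{n,b₀} = D_n z_{ℚ_{b₀}(μ_n)} mod I_n`, exists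
and `cores_{ℚ_{b₀}/ℚ} κ_{n,b₀} = κ̃_n` (uniqueness of the descent; `cores ∘ D_n = D_n ∘ cores`); `κ^{Kato}_n = κ̃_n`
with no modification (Kim AJM p. 12) [derivative classes over the layers of a `ℤ_p`-extension are Rubin's
`κ_{[F,r,M]}`: Cetraro lectures, Coates–Greenberg–Ribet–Rubin 1999, §8.2 and §§11–12]. (b) BOCKSTEIN: for a
`p`-adic field `K` and `y ∈ H¹(K, T/p^j)`, `δ_k(y mod p^k) = p^{j−k} · δ_j(y)` in `H²(K,T)` (compare the sequences
`0 → T → T → T/p^j → 0` and `0 → T → T → T/p^k → 0`), so `y mod p^k ∈ im H¹(K,T)` as soon as `p^{j−k}` kills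
`H²(K,T)_{tors} ≅ (E(K)[p^∞])^∨` (local duality, Weil pairing) — for `K = ℚ_{p,b₀}` as soon as `j − k ≥ m′`.
(c) So `loc_p κ̃_n mod p^k = cores_{ℚ_{p,b₀}/ℚ_p}(loc κ_{n,b₀}) mod p^k = cores(w) mod p^k` with
`w ∈ H¹(ℚ_{p,b₀}, T)` (`p` is totally ramified in `ℚ_{b₀}`, one prime, completion `ℚ_{p,b₀}`), and
`cores H¹(ℚ_{p,b₀},T) = U`: `U = ⋂_b cores H¹(ℚ_{p,b},T)` (compactness of the finitely generated `ℤ_p`-modules) has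
finite index (`H¹(ℚ_p,T)/U ≅ H²_Iw(ℚ_p,T)^Γ`, of order `p^m`), so the decreasing norm subgroups are stationary `= U`
from some layer `b₀` on. ∎ The germ slack `j − k ≥ m′` is the same device as Greenberg's universal-norm argument for
the Tate period (Cetraro lectures 1999, Prop. 3.11, pp. 99–100). At split multiplicative `p ≥ 3`:
`E(ℚ_{p,b})[p^∞] = E(ℚ_p)[p^∞]` for every layer `b` (`q = q₁^{p^m}` with `q₁ ∉ (ℚ_pˣ)^p`; `q₁ = y^p` with
`y ∈ ℚ_{p,b}` would make `ℚ_p(y) = ℚ_{p,1}` Galois over `ℚ_p`, forcing `ζ_p ∈ ℚ_{p,1}` — impossible for odd `p`;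
and `μ_p ⊄ ℚ_{p,∞}`), so `m′ = m`, `H²_Iw(ℚ_p,T) ≅ ℤ/p^m` with trivial `Γ`-action and `H¹(ℚ_p,T)/U ≅ ℤ/p^m`
(critic V265's `Q`). W3: the door uses (1′) at split `p` only; S1♭'s statement is kept for ANY reduction at `p`,
where `m′ ≤ ord_p #E(ℚ_{p,∞})[p^∞] < ∞` (Imai at potentially good `p`, the Tate curve otherwise) and the same
proof runs — the LEAD may narrow S1♭ to split multiplicative `p` to spare a prover that finiteness (optional).
PRINT STATUS after rev 3.1 (W2's honesty layer, PRINT vs LEMMA): `m = 0` — print (MR Thm. 3.2.4's last clause,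
rev 2's S1); `∂^{(∞)}(κ^{Kato}) ≥ 1` whenever `E(ℚ_p)[p] ≠ 0` — print at REMARK level (Büyükboduk 2011 Remark 10:
«using the proof of Proposition 6.2.6 [MR] one can show `p ∣ #coker{KS̄(T⊗Λ,F_can) → KS̄(T,F_can)}` if
`|(T^*)^{G_{ℚ_p}}| > 1`», arXiv:0706.0377 p. 20, with §4.1 p. 22 and `KS(T) ≅ ℤ_p`) — this already covers ALL 47 J3
census pairs (`m = 1`); `∂^{(∞)}(κ^{Kato}) ≥ m` for every `m` — LEMMA D_p = (1′)+(2′)+(3)+(4)+(5), every step over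
a printed theorem except (1′) = UN-germ above (local Galois cohomology only). W2 (shape): D_p as its OWN stub needs
Kolyvagin-system vocabulary (`KS(T,F,𝒫)`, `∂^{(∞)}`) that the tree does not have — a definition request for the
pen (D1 `MazurRubin2004.KolyvaginSystem` / `SelmerStructure.propagate`), after which S1♭ splits as S1(print:
`length Sel₀ = ∂⁰ − ∂^{(∞)}`, Kim Thm. 2.14 (7)) ∧ D_p (`∂^{(∞)} ≥ m`); until then the split lives in this docstring
(LEAD / pen call, W-79). NOT USED (dead as a citation, recorded): restricting to Kolyvagin primes `ℓ` with
`p ∤ ord_ℓ(p)` gives FULL-level membership by a prime-to-`p` local descent, but such a prime set violates MR's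
hypothesis H5 «`𝒫 ⊇ 𝒫_t`» (Büyükboduk 2009 p. 7), so MR §§4–5 would not apply to it verbatim.

CONSEQUENCE FOR THE SKELETON. S1 becomes S1♭ (`stub_katoKolyvaginLogBoundLocalTorsion`: S1's print chain with
`∂^{(∞)} ≥ m` kept instead of dropped — `+ m` on the left for every `m` such that `E(ℚ_p)` has a point of order
`p^m`; `m = 0` is rev 2's S1 verbatim), S2 becomes S2′ (`stub_tateUniformisationLogMinimum`: the local witness at
valuation `1 − ord_p c_p + m` WITHOUT the hypothesis `E(ℚ_p)[p] = 0`, routine on the Tate curve), S1♯ becomes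
S1♯′ (the away-from-`p` defect AND `m`; print-open exactly as before: Büyükboduk's Question 2), S3 is unchanged,
and the residual S4′ (`stub_nonSplitResidual`) is «`p` NON-SPLIT multiplicative» ALONE = J1 (34 of the 404
census pairs). Door after rev 3 = ALL split `p`: 334 pairs through S1♭ ∧ S2′ ∧ S3 (door 287 + J3 47, no
print-open input) and 36 J2 pairs through S1♯′ ∧ S2′ ∧ S3 (one print-open input, as in rev 2; the census has NO
J2 pair with `m ≥ 1`: 129360cy1@5 is the only J2 pair with `p ∣ c_p`, and there `m = 0`).

BARRIER PLACEMENT (catalogue `Literature/Barriers/BirchSwinnertonDyer/`). `StringentKolyvaginCapsAtMax`: D_p IS a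
bounded refinement at ONE place (`v = p`, multiplier `p^m`: `p^m · H¹(ℚ_p,T) ≤ U`) used through Büyükboduk's
Cor. 2.8 (the «⊆» direction the barrier grants); on the S1♭ branch `p` is the ONLY place of defect (`p` the only
prime carrying `p` in `∏ c_ℓ · #E(ℚ_p)[p^∞]`), so «max = Σ» and the wall does not bite (its own scope: Jetchev
Cor. 1.5 / «at most one Tamagawa number»); on the S1♯′ branch (two or more defect places) it bites head-on —
that is WHY S1♯′ stays print-open and is not claimed. `ExceptionalZero`: not this class (no `p`-adic
`L`-function, no `𝓛`-invariant; the strict Selmer side). `PAdicHeightNondegeneracy`: not met (no height).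

## The line in one paragraph (rev 3)

For `(E, p)` in the target class (X11b, `p ≥ 5`, `ρ̄_{E,p}` onto, no (ram) prime, `p ∣ ∏ c_ℓ`, no
inert-set datum) the Euler half `ord_p #Ш ≤ ord_p #Ш_an` is read off the BOTTOM LAYER of Kato's
`Ω_E`-normalised Λ-adic zeta element — the tree's ADMISSIBLE class `z₀` (`Kato2004.IsAdmissibleZetaClass`,
realisable at `p ≥ 5`, `ρ̄` onto, by the tree's named fact `exists_isAdmissibleZetaClass_of_imageContainsSL2`
= Kato Thm. 12.5 (4)) — through its KUMMER LOGARITHM `t = log_ω(loc_p z_ℚ)` (`Kato2004.HasLocPKummerLog`,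
tree currency, no `B_dR`), NOT through a `p`-adic height. On `p` SPLIT multiplicative:

* `stub_katoKolyvaginLogBoundLocalTorsion` S1♭ (PRINT CHAIN + LEMMA D_p, size L–XL; ANY reduction type at `p`):
  `ord_p #Ш + ord_p log_ω(x̂) − ord_p log_ω(Q) + m ≤ ord_p t − ord_p log_ω(x̂)` for every local point `Q` with
  `log_ω(Q) ≠ 0` and every `m` with a point of order `p^m` in `E(ℚ_p)`.
* `stub_katoKolyvaginLogBoundDefect` S1♯′ (PRINT-OPEN, XL): the same with `(ord_p ∏c_ℓ − ord_p c_p) + m` when a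
  second prime carries `p` in the Tamagawa product (Büyükboduk Question 2; BSD-predicted with equality).
* `stub_tateUniformisationLogMinimum` S2′ (PROVABLE, M–L, Tate curve): some `m`, a point `Q₀` of order `p^m` and
  a point `Q` with `log_ω(Q) ≠ 0`, `ord_p log_ω(Q) = 1 − ord_p c_p + m`.
* `stub_integralExcZeroValue` S3 = THE TRANSFER STATEMENT C⁺ (research, XL; the door; unchanged from rev 2).
* `stub_nonSplitResidual` S4′ (honest residual): the crux at `p` NON-SPLIT multiplicative (J1).
* `stub_printedFactsHeld` S0 (CITE): GZK ∧ Kato Thm. 12.5 (4) realisability (tree named facts).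

Composition `EulerHalfNotRamNoInertSetAtFive_of` (kernel-checked, no sorry): on `p` split, S2′ gives
`(m, Q₀, Q)`, S3 gives `(q, t)`; with `ord_p ∏c_ℓ = ord_p c_p` → S1♭ and `sha_le_of_doorGraded`; with `≠` →
S1♯′ and `sha_le_of_doorTwoGraded` (the `m`'s cancel between S1♭/S1♯′ and S2′ — the graded chain
`sha_le_graded_of_chain` of rev 2 with `d = m`, resp. `d = (ctot − c) + m`); otherwise S4′. BSD-tight in both
split branches, and consistent only because `ord_p #E(ℚ)_tors = 0` (automatic: `ρ̄` onto, `p ≥ 5`) — W1 of rev 2.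

KS-IMPRIMITIVITY LEDGER (card §J of `Lines/kato_Fframe.md`): BSD predicts `∂^{(∞)}(κ^{Kato}) = Σ_{ℓ≠p} ord_p c_ℓ
+ m` exactly; rev 3 PROVES (on paper, D_p) the `m` part as an inequality and leaves the `Σ_{ℓ≠p}` part named
(S1♯′). Why no posited integer interface: as rev 2 (junk-false / non-composing; the waist is tree vocabulary).

Disproof ledger honoured: none of the stubs is an instance of a landed Negative lemma of this crux
(`ledger negatives --problem BirchSwinnertonDyer`: no statement about `HasLocPKummerLog` / admissible
classes / `MissingUpperBoundAt` at a multiplicative prime is refuted); S4′ is strictly weaker than the crux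
(extra hypothesis), and no stub implies the crux or the route leaf cheaply (probe table in the card).
-/

noncomputable section

open scoped Classical

set_option linter.dupNamespace false

namespace Summit.BirchSwinnertonDyer.BirchSwinnertonDyer.Cruxes.EulerHalfNotRamNoInertSetAtFive.KatoFframe

open Field
open Literature.NumberTheory.GaloisRepresentations
open Literature.NumberTheory.EllipticCurves Literature.NumberTheory.EllipticCurves.Kato2004
open Literature.NumberTheory.EllipticCurves.Kato2004.EulerSystemValues
open Literature.NumberTheory.EllipticCurves.Rank1Residual
open Literature.NumberTheory.EllipticCurves.Rank1Residual.Typed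
open Summit.BirchSwinnertonDyer.Rank1Residual
open Summit.BirchSwinnertonDyer.BirchSwinnertonDyer.Theses.ErratumRoadFive

/-! ## §0 Vocabulary (definitions with bodies; nothing asserted) -/

/-- `E(ℚ) → E(ℚ_p)` on points (Mathlib's `Point.map` along `ℚ → ℚ_p`; same body as the tree's
`WeierstrassCurve.toPadicPoint`). [folklore] -/
abbrev toLocalPoint (W : WeierstrassCurve ℚ) (p : ℕ) [Fact p.Prime] :
    W.toAffine.Point →+ (W.baseChange ℚ_[p]).toAffine.Point :=
  WeierstrassCurve.Affine.Point.map (W' := W.toAffine) (S := ℚ) (Algebra.ofId ℚ ℚ_[p])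

/-- `log_ω(x) ∈ ℚ_p` of a RATIONAL point `x ∈ E(ℚ)` (Néron differential, `W` globally minimal):
`padicLogLocal` of its image in `E(ℚ_p)`. [cite: SilvermanAEC2009, IV.6.4 and VII.2.2] -/
def logOmega (W : WeierstrassCurve ℚ) [W.IsElliptic] [W.IsGloballyMinimal] (p : ℕ) [Fact p.Prime]
    (x : W.toAffine.Point) : ℚ_[p] :=
  padicLogLocal W p (toLocalPoint W p x)

/-- The BOTTOM LAYER `z_ℚ ∈ H¹(ℚ, T_pE)` of a class `z₀` of a pinned Iwasawa cohomology
`I : IwasawaH1Data W p K γ` (`I.proj 0`, moved to `⊤` by `layerZeroToTop`).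
[cite: Kato2004Asterisque, §12.2 (p. 220) and §14.14 (14.14.1) (p. 243)] -/
def bottomClass (W : WeierstrassCurve ℚ) [W.IsElliptic] (p : ℕ) [Fact p.Prime]
    [ContinuousSMul ℤ_[p] (W.tateModule p)] (K : ZpExtension ℚ p) {γ : absoluteGaloisGroup ℚ}
    (I : IwasawaH1Data W p K γ) (z₀ : I.H) : H1 (tateRep W p) ⊤ :=
  layerZeroToTop W p K (I.proj 0 z₀)


/-! The regimes are stated INLINE in the stub signatures (rev 2 hygiene kept: no `def … : Prop` in a crux
workfile): «`W.HasSplitMultiplicativeReductionAtPrime p`» (`p` split multiplicative), «`padicValNat p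
W.tamagawaProduct = padicValNat p (padicValInt p W.minimalDiscriminantInt)`» (`ord_p ∏c_ℓ = ord_p c_p`, `c_p =
ord_p Δ_min` at a split multiplicative prime), «`addOrderOf Q₀ = p ^ m`» (a local point of order `p^m`, so
`p^m ∣ #E(ℚ_p)[p^∞]`; rev 3 replaces rev 2's «`∀ Q, p • Q = 0 → Q = 0`» by this graded datum). -/

/-! ## §1 The registered-shape stubs (k = 6; sorries ONLY here) -/

/-- **S0 (CITE) printed facts held as tree named facts**: Gross–Zagier–Kolyvagin («`r_an ≤ 1 ⇒ rank =
r_an ∧ Ш finite`») and Kato Thm. 12.5 (4) realisability of an admissible zeta class in every pinned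
`𝐇¹_Γ(T_pE)` under (12.5.2). Closed at route level by `(h : Fact)` binders, never by a proof here.
[cite: Kato2004Asterisque, Thm. 12.5 (4) with (12.5.2) (p. 222)] [cite: Darmon2004, Thm. 3.22] -/
theorem stub_printedFactsHeld :
    rank_eq_analyticRank_of_analyticRank_le_one ∧ exists_isAdmissibleZetaClass_of_imageContainsSL2 := by
  sorry

/-- **S1♭ (PRINT CHAIN + LEMMA D_p, L–XL; new in rev 3, SUPERSEDES S1) Kato–Kolyvagin bound in logarithm
currency at analytic rank one WITH THE DEFECT AT `p` BOOKED, any reduction at `p`.** For `p ≥ 5`, `ρ̄_{E,p}`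
onto, `r_an(E) = 1`, a Mordell–Weil generator `x̂ = P 0`, an admissible Kato class `z₀` with bottom Kummer
logarithm `t ≠ 0`, ANY `m` such that `E(ℚ_p)` has a point `Q₀` of order `p^m`, and ANY local point `Q` with
`log_ω(Q) ≠ 0`: `ord_p #Ш + ord_p log_ω(x̂) − ord_p log_ω(Q) + m ≤ ord_p t − ord_p log_ω(x̂)`. At `m = 0`
(`Q₀ = 0`) this is rev 2's S1 verbatim. Print chain (as S1): MR Thm. 5.2.2 + 5.2.12 / Kim 2022 Thm. 2.12 +
Cor. 2.15 (`length Sel₀(ℚ,E[p^∞]) ≤ ∂⁰(κ^{Kato}) − ∂^{(∞)}(κ^{Kato})`, `κ₁ ∈ ℤ_pˣ·z_ℚ`, `Sel₀` = `p`-STRICT);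
`length Sel₀ = ord_p #Ш + e`, `e = ord_p log_ω(x̂) − min ord_p log_ω` (rank one, `Ш[p^∞]` finite by GZK);
`Sel_rel(ℚ,T_pE) = ℤ_p x̂` (Bloch–Kato Ex. 3.11, `E(ℚ)[p] = 0`), so `∂⁰ = ord_p t − ord_p log_ω(x̂)`; PLUS the one
new input, LEMMA D_p of the header: `∂^{(∞)}(κ^{Kato}) ≥ ord_p #E(ℚ_p)[p^∞] ≥ m` (universal-norm Selmer structure
at `p`: LEMMA UN-germ (header § «rev 3.1»: derivative classes over a layer `ℚ_{b₀}` + Bockstein slack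
`p^{j−k}` + stationarity of norm subgroups) → GERM-level propagated condition `U = im H¹_Iw(ℚ_p,T)` of index
`#E(ℚ_p)[p^∞]` [Büyükboduk 2011 Prop. 12 proof, p. 24; Remark 10, p. 20] → Büyükboduk 2009 Prop. 2.7 + Cor. 2.8 /
Thm. 2.3 (i) AT `ℓ = p` (`KS(T/pⁿ, F_univ, 𝒫 ∩ 𝒫_j) = 0`, `n ≤ m`) → MR Thm. 5.2.10 / Kim Prop. 2.8 + Thm. 2.14 (7)).
HONESTY LAYER (rev 3.1, critic V265 W2): PRINT = the `m = 0` frame (MR 3.2.4's last clause; rev 2's S1) and, at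
remark level, `∂^{(∞)} ≥ 1` when `E(ℚ_p)[p] ≠ 0` (Büyükboduk 2011 Remark 10 ⇐ proof of MR Prop. 6.2.6) — enough for
every J3 census pair (`m = 1`); LEMMA = D_p for general `m` (header). Why it might fail: (i) [rev 3.1] D_p is stated
nowhere in print as such; its at-`p` input is now LEMMA UN-germ (ours, elementary, written out in the header)
instead of a reading of Mazur–Rubin's `F_Λ` convention — rev 3's risk (R-conv) is resolved (the induced structure
IS the propagated one, Büyükboduk 2011 p. 24, and membership is proved at the germ level, which is all `KS̄ = KS`
sees); what could still fail is a bookkeeping slip in (2′)–(5) (prime sets `𝒫 ∩ 𝒫_j`, H5/H6 for `(T/p^k, F_univ)`,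
the core-vertex step), each checked here against arXiv:0710.3858 pp. 7–10 and arXiv:2203.12159 pp. 12–14 and, for
(2)–(5), by critic V265; (ii) as S1:
the `ℤ_pˣ`-identification of the admissible bottom layer with `κ₁` after Kato's multiplier is divided out.
Serves: the door (m = 0, 287 pairs) AND J3 (`p` split, `E(ℚ_p)[p] ≠ 0`: 47 of the 334 door-type census pairs,
36 at `p = 5`, 11 at `p = 7`, all `m = 1`; smallest 5600t1@7, 6615d1@5, 6615i1@5, 11200ck1@7).
[cite: MazurRubin2004, Thm. 5.2.2, Thm. 5.2.10, Thm. 5.2.12 and Thm. 5.3.3] [cite: Kim2022StructureSelmer, Thm. 2.12,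
Cor. 2.15, Prop. 3.1 and Thm. 4.3] [cite: Buyukboduk2009TamagawaDefect, Prop. 2.7, Cor. 2.8 and Thm. 3.1–3.2
(arXiv:0710.3858 pp. 8–10)] [cite: Buyukboduk2011LambdaAdicKS, Remark 10 (arXiv:0706.0377 p. 20) and Prop. 12 (p. 24)]
[cite: BlochKato1990, Ex. 3.11] -/
theorem stub_katoKolyvaginLogBoundLocalTorsion :
    ∀ (W : WeierstrassCurve ℚ) [W.IsElliptic] [W.IsGloballyMinimal] (p : ℕ) [Fact p.Prime]
      [ContinuousSMul ℤ_[p] (W.tateModule p)],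
      5 ≤ p → Surj W p → W.analyticRank = 1 →
      ∀ (h1 : W.mordellWeilRank = 1) (P : Fin W.mordellWeilRank → W.toAffine.Point),
        W.IsMordellWeilBasis P →
      ∀ (K : ZpExtension ℚ p) (hK : K.IsCyclotomic) (γ : absoluteGaloisGroup ℚ)
        (I : IwasawaH1Data W p K γ) (z₀ : I.H), K.IsTopGenerator γ → IsAdmissibleZetaClass W p K hK I z₀ →
      ∀ t : ℚ_[p], HasLocPKummerLog W p (bottomClass W p K I z₀) t → t ≠ 0 →
      ∀ (m : ℕ) (Q₀ : (W.baseChange ℚ_[p]).toAffine.Point), addOrderOf Q₀ = p ^ m →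
      ∀ Q : (W.baseChange ℚ_[p]).toAffine.Point, padicLogLocal W p Q ≠ 0 →
        (padicValNat p W.shaOrder : ℤ) + (logOmega W p (P (Fin.cast h1.symm 0))).valuation
            - (padicLogLocal W p Q).valuation + m ≤
          t.valuation - (logOmega W p (P (Fin.cast h1.symm 0))).valuation := by
  sorry

/-- **S1♯′ (PRINT-OPEN, XL; rev 2's S1♯ graded by `m`) Kato–Kolyvagin bound WITH THE FULL BSD-PREDICTED
DEFECT, log currency, split multiplicative `p` with a SECOND prime carrying `p` in the Tamagawa product
(`ord_p ∏c_ℓ ≠ ord_p c_p`, `c_p = ord_p Δ_min`).** Then for every `m` with a local point of order `p^m`: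
`ord_p #Ш + ord_p log_ω(x̂) − ord_p log_ω(Q) + (ord_p ∏c_ℓ − ord_p c_p) + m ≤ ord_p t − ord_p log_ω(x̂)`.
Equivalently (given S1♭'s chain): `∂^{(∞)}(κ^{Kato}) ≥ Σ_{ℓ≠p} ord_p c_ℓ + ord_p #E(ℚ_p)[p^∞]` — the SUM over
all defect places. Status: EACH single place is in hand (any one `ℓ ≠ p`: Büyükboduk 2009 Thm. B; the place
`p`: LEMMA D_p), and local-condition refinements give only the MAXIMUM over places — catalogued barrier
`Literature.Barriers.BirchSwinnertonDyer.StringentKolyvaginCapsAtMax`, which this stub would have to beat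
HEAD-ON or evade through an IMC / control input (its evasion (i): BCGS Thm. 2 at good ordinary `p`); the SUM
is Büyükboduk's Question 2 (open) = the Tamagawa part of Kim's Conj. 1.10; for `p ∤ N` GIVEN Kato's IMC it is
Castella–Sano 2026 (eq:M-kato). BSD predicts the statement with EQUALITY at the minimising `Q`. Serves the J2
pairs (36 of the 404 census pairs: 33 at `p = 5`, 2 at `p = 7`, 1 at `p = 11`; smallest 8085y1@5, 12705q1@7,
16905bb1@5; at all 36 `m = 0` — the only one with `p ∣ c_p`, 129360cy1@5, has `u_q ∉ (ℤ_pˣ)^p`). Why it might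
fail: it should not (BSD-predicted); what fails is provability inside the technique class (the barrier).
[cite: Buyukboduk2009TamagawaDefect, Thm. B and §4.2 Question 2 (arXiv:0710.3858 pp. 2, 12)]
[cite: Kim2022StructureSelmer, Conj. 1.10 and Thm. 2.12] [cite: CastellaSano2026, §2.4 (eq:M-kato)]
[cite: Jetchev2008, Cor. 1.5] -/
theorem stub_katoKolyvaginLogBoundDefect :
    ∀ (W : WeierstrassCurve ℚ) [W.IsElliptic] [W.IsGloballyMinimal] (p : ℕ) [Fact p.Prime]
      [ContinuousSMul ℤ_[p] (W.tateModule p)],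
      5 ≤ p → Surj W p → W.analyticRank = 1 → W.HasSplitMultiplicativeReductionAtPrime p →
      padicValNat p W.tamagawaProduct ≠ padicValNat p (padicValInt p W.minimalDiscriminantInt) →
      ∀ (h1 : W.mordellWeilRank = 1) (P : Fin W.mordellWeilRank → W.toAffine.Point),
        W.IsMordellWeilBasis P →
      ∀ (K : ZpExtension ℚ p) (hK : K.IsCyclotomic) (γ : absoluteGaloisGroup ℚ)
        (I : IwasawaH1Data W p K γ) (z₀ : I.H), K.IsTopGenerator γ → IsAdmissibleZetaClass W p K hK I z₀ →
      ∀ t : ℚ_[p], HasLocPKummerLog W p (bottomClass W p K I z₀) t → t ≠ 0 →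
      ∀ (m : ℕ) (Q₀ : (W.baseChange ℚ_[p]).toAffine.Point), addOrderOf Q₀ = p ^ m →
      ∀ Q : (W.baseChange ℚ_[p]).toAffine.Point, padicLogLocal W p Q ≠ 0 →
        (padicValNat p W.shaOrder : ℤ) + (logOmega W p (P (Fin.cast h1.symm 0))).valuation
            - (padicLogLocal W p Q).valuation
            + (((padicValNat p W.tamagawaProduct : ℤ) - padicValNat p (padicValInt p W.minimalDiscriminantInt))
                + m) ≤
          t.valuation - (logOmega W p (P (Fin.cast h1.symm 0))).valuation := by
  sorry

/-- **S2′ (PROVABLE, M–L; rev 2's S2 without the hypothesis `E(ℚ_p)[p] = 0`) Tate-uniformisation log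
MINIMUM.** At a split multiplicative prime `p ≥ 5` there are `m : ℕ`, a local point `Q₀` of order EXACTLY `p^m`
and a local point `Q` with `log_ω(Q) ≠ 0` and `ord_p log_ω(Q) = 1 − ord_p(c_p) + m` (`c_p = ord_p Δ_min`).
Intended witnesses (`E(ℚ_p) ≅ ℚ_pˣ/q^ℤ`, `q = p^e u`, `e = c_p`, `log_ω = log_q ∘ Φ_Tate⁻¹` with `log_q(q) = 0`,
i.e. `log_q(p) = −log_p(u)/e`; put `s := ord_p log_p(u) − 1 ≥ 0`): `m := min(ord_p e, s) = ord_p #E(ℚ_p)[p^∞]`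
(`E(ℚ_p)[p^∞]` is cyclic of that order: `x^{p^k} ∈ q^ℤ` has a solution `x ∉ q^ℤ·μ` iff `q ∈ (ℚ_pˣ)^{p^k}` iff
`p^k ∣ e ∧ u ∈ (ℤ_pˣ)^{p^k}` iff `k ≤ min(ord_p e, s)` — Kim AJM Prop. 3.1 prints the first conjunct only),
`Q₀ := Φ_Tate(q^{1/p^m})`, and `Q := Φ_Tate(p)` if `s < ord_p e` (valuation `s + 1 − ord_p e = 1 − c + m`),
`Q := Φ_Tate(1 + p)` if `s ≥ ord_p e` (valuation `1 = 1 − c + m`). At `m = 0` this is rev 2's S2 (witnesses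
`Φ_Tate(p)` / `Φ_Tate(1+p)`). Why it might fail: only through the normalisation of `padicLogLocal`
(`log(m₀•Q)/m₀`, `m₀ = [E(ℚ_p):E₁(ℚ_p)] = (p−1)·ord_p Δ_min`, re-derived in rev 2 to give `log_q`) or a slip in
the cyclic-torsion count above (checked numerically on the census: g36 script `j3count-kato_Fframe_v2.py`,
`u^{p−1} ≡ 1 mod p²` test). Leans on: tree `SteinWuthrich2013/SplitUniformizationData*`, `padicLogPoint`.
[cite: SilvermanATAEC1994, V.3.1, V.4.1 and V.5.3] [cite: SilvermanAEC2009, IV.6.4 (b)] [cite: Kim2022StructureSelmer, Prop. 3.1] -/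
theorem stub_tateUniformisationLogMinimum :
    ∀ (W : WeierstrassCurve ℚ) [W.IsElliptic] [W.IsGloballyMinimal] (p : ℕ) [Fact p.Prime],
      5 ≤ p → W.HasSplitMultiplicativeReductionAtPrime p →
      ∃ (m : ℕ) (Q₀ Q : (W.baseChange ℚ_[p]).toAffine.Point), addOrderOf Q₀ = p ^ m ∧
        padicLogLocal W p Q ≠ 0 ∧
        (padicLogLocal W p Q).valuation =
          1 - (padicValNat p (padicValInt p W.minimalDiscriminantInt) : ℤ) + m := by
  sorry

/-- **S3 (THE TRANSFER C⁺, XL — the door) integral exceptional-zero Perrin-Riou value, valuation form,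
upper half.** For `(E,p)` in X11b with `p ≥ 5`, `ρ̄_{E,p}` onto and `p` SPLIT multiplicative, a Mordell–Weil
generator `x̂ = P 0` and an admissible Kato class `z₀`: `#Ш_an` is a rational `q`, the bottom layer of `z₀`
has a NON-ZERO Kummer logarithm `t` (Venerucci Thm. A (2) + Thm. B at `r_an = 1`), and
`ord_p t − 2·ord_p log_ω(x̂) ≤ ord_p q + ord_p ∏ c_ℓ − 2·ord_p #E(ℚ)_tors − 1` (`−1 = ord_p(1 − p⁻¹)`).
Print: equality up to `ℚˣ` (Venerucci 2016 Thm. A `log_A(res_p ζ^{BK}) = ℓ₁ log_A²(𝐏)` [arXiv:1407.1913 p. 3];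
Disegni 2020 Prop. 5). Proposed proof of the integral form = F-frame chain S3–S6 of
`Lines/kato_bottom_layer_Fframe.md` rev 1.3 (Stage 2). Why it might fail: an uncancelled `p`-power in the
unwinding constants (Manin constant of the Shimura-curve parametrisation over `F`, Mok's `ξ(2)`, the
Petersson-measure ratio — audited to `κ = 0` in words only), or `ℓ₁`'s `ord_p(q_E)` entering with the
wrong sign. BOOKKEEPING (critic W1): the term `− 2·ord_p #E(ℚ)_tors` is `0` here (`ρ̄` onto, `p ≥ 5` ⇒ `E(ℚ)[p] = 0`)
and the door chain S1 ∧ S2 ∧ S3 is BSD-consistent — indeed BSD-TIGHT, equalities throughout — ONLY because of it;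
do not «generalise» S3 to `p ∣ #E(ℚ)_tors`. Standing hypotheses of the print support (Venerucci Thm. A):
conductor `Np`, `p > 3` split multiplicative, `A_p` irreducible, `L(A,1) = 0`; no hypothesis on `ord_p(q_A)`.
[cite: Venerucci2016, Thm. A] [cite: Disegni2020, Prop. 5] [cite: Mok2011, Thm. 1.1] [cite: PerrinRiou1993AIF, §3.3] -/
theorem stub_integralExcZeroValue :
    ∀ (W : WeierstrassCurve ℚ) [W.IsElliptic] [W.IsGloballyMinimal] (p : ℕ) [Fact p.Prime]
      [ContinuousSMul ℤ_[p] (W.tateModule p)],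
      ClassX11b W p → 5 ≤ p → Surj W p → W.HasSplitMultiplicativeReductionAtPrime p →
      ∀ (h1 : W.mordellWeilRank = 1) (P : Fin W.mordellWeilRank → W.toAffine.Point),
        W.IsMordellWeilBasis P →
      ∀ (K : ZpExtension ℚ p) (hK : K.IsCyclotomic) (γ : absoluteGaloisGroup ℚ)
        (I : IwasawaH1Data W p K γ) (z₀ : I.H), K.IsTopGenerator γ → IsAdmissibleZetaClass W p K hK I z₀ →
      ∃ (q : ℚ) (t : ℚ_[p]), shaAn W = (q : ℂ) ∧ HasLocPKummerLog W p (bottomClass W p K I z₀) t ∧ t ≠ 0 ∧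
        t.valuation - 2 * (logOmega W p (P (Fin.cast h1.symm 0))).valuation ≤
          padicValRat p q + padicValNat p W.tamagawaProduct - 2 * padicValNat p W.torsionOrder - 1 := by
  sorry

/-- **S4′ (RESIDUAL, honest and named; rev 3 = J1 ALONE) the crux at a NON-SPLIT multiplicative `p`.** The crux
hypotheses together with `¬ (p split multiplicative)`: in the class (X11b: `p ∥ N`) this is `p` NON-SPLIT
multiplicative — no exceptional zero, `c_p ∈ {1,2}`, so the Tamagawa-`p` primes are some `ℓ ≠ p` (at least two,
by the no-inert-set hypothesis); input type = S1♯′ at those `ℓ` (barrier `StringentKolyvaginCapsAtMax` bites: two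
defect places) + a rank-one Perrin-Riou value at a NON-split prime (no print found by this seat: Venerucci's Thm. A
is split multiplicative; at non-split `p` there is no exceptional zero and the bottom-layer value is the ordinary
Perrin-Riou / Kobayashi shape `(1 − a_p p⁻¹)²`-type factor times `L′`-data — the integral form is not in print at
`p ∥ N`). 34 of the 404 census pairs (27 at `p = 5`, 7 at `p = 7`; smallest 8670u1@5, 14560d1@5, 15390r1@5,
17955m1@7), census TSV `bsd-stepL/shim/notram_census_j254667.tsv` column `splitp = 0`. rev 2's J3 (47 pairs) has
LEFT the residual (S1♭), rev 2's J2 is served by S1♯′ as before. Coverage by the line of record: `birth.lean` v17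
closes the WHOLE class modulo the published inputs {19066, 19524, 19716, 20442, 23091} + crux 19064 at `p ≥ 5`, so
keying this file strands nothing. Strictly weaker than the crux; no line of this file reaches it. Why it might
fail: it is the crux on a sub-class. [cite: Kato2004Asterisque, Thm. 17.4] [cite: Kim2022StructureSelmer, Thm. 2.12] -/
theorem stub_nonSplitResidual :
    ∀ (W : WeierstrassCurve ℚ) [W.IsElliptic] [W.IsGloballyMinimal] (p : ℕ) [Fact p.Prime],
      ClassX11b W p → 5 ≤ p → Surj W p → ¬ Ram W p → p ∣ W.tamagawaProduct →
      ¬ (∃ S : Finset ℕ, (∀ ℓ ∈ S, ∃ _ : Fact ℓ.Prime, Mult W ℓ) ∧ Even S.card ∧ p ∈ S ∧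
          (∀ (ℓ : ℕ) [Fact ℓ.Prime], ℓ ∉ S → W.HasSplitMultiplicativeReductionAtPrime ℓ →
            ¬ p ∣ padicValInt ℓ W.minimalDiscriminantInt) ∧
          (¬ p ∣ padicValInt p W.minimalDiscriminantInt ∨
            ∃ R ⊆ S, S.card = 2 * R.card ∧ ∀ q ∈ R, q ≠ 2 ∧ ¬ p ∣ q - 1)) →
      ¬ W.HasSplitMultiplicativeReductionAtPrime p →
      MissingUpperBoundAt W p := by
  sorry

/-! ## §2 The composition (kernel-checked; concludes the crux BY NAME) -/

/-- The GRADED bottom-layer chain at a split multiplicative prime, as pure arithmetic over `ℤ` (rev 2, kept):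
a Kolyvagin bound `hB` carrying a booked defect `d` on the left, the local minimum `hQ : vQ = 1 − c + m`
(`m = ord_p #E(ℚ_p)[p^∞]`, S2′) and the C⁺ value `hC` (S3) give `sha ≤ vq + (ctot − c − d) + m − 2·vtors` — the
Euler half exactly when the booked defect `d` reaches `(ctot − c) + m`. -/
theorem sha_le_graded_of_chain (sha vx vQ vt vq ctot c m d vtors : ℤ)
    (hB : sha + vx - vQ + d ≤ vt - vx) (hQ : vQ = 1 - c + m)
    (hC : vt - 2 * vx ≤ vq + ctot - 2 * vtors - 1) :
    sha ≤ vq + (ctot - c - d) + m - 2 * vtors := by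
  omega

/-- The graded door branch (rev 3; `d = m`): `hB` = S1♭ at the S2′-witnesses `(m, Q₀, Q)`, `hQ` = S2′, `hC` = S3,
`hcc` = `ord_p ∏c_ℓ = ord_p c_p`. The `m`'s cancel: this is rev 2's `sha_le_of_door` at every `m`. -/
theorem sha_le_of_doorGraded (sha vx vQ vt vq ctot c m vtors : ℤ)
    (hB : sha + vx - vQ + m ≤ vt - vx) (hQ : vQ = 1 - c + m)
    (hC : vt - 2 * vx ≤ vq + ctot - 2 * vtors - 1) (hcc : ctot = c) (htors : 0 ≤ vtors) :
    sha ≤ vq := by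
  have h := sha_le_graded_of_chain sha vx vQ vt vq ctot c m m vtors hB hQ hC
  omega

/-- The graded J2 branch (rev 3; `d = (ctot − c) + m`): `hB` = S1♯′, `hQ` = S2′, `hC` = S3; NO sign condition on
`ctot − c`. -/
theorem sha_le_of_doorTwoGraded (sha vx vQ vt vq ctot c m vtors : ℤ)
    (hB : sha + vx - vQ + ((ctot - c) + m) ≤ vt - vx) (hQ : vQ = 1 - c + m)
    (hC : vt - 2 * vx ≤ vq + ctot - 2 * vtors - 1) (htors : 0 ≤ vtors) :
    sha ≤ vq := by
  have h := sha_le_graded_of_chain sha vx vQ vt vq ctot c m ((ctot - c) + m) vtors hB hQ hC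
  omega

/-- **`EulerHalfNotRamNoInertSetAtFive` from the six stubs (rev 3).** On `p` split multiplicative: GZK gives rank
one and a Mordell–Weil generator (tree theorem `exists_isMordellWeilBasis_holds`), Kato 12.5 (4) an admissible
class (tree corollary `exists_datum_of_hasSurjectiveModNGaloisRep`), S3 the value, S2′ the graded local witnesses
`(m, Q₀, Q)`, then S1♭ (`ord_p ∏c_ℓ = ord_p c_p`, `sha_le_of_doorGraded`) or S1♯′ (`≠`, `sha_le_of_doorTwoGraded`);
at a non-split `p`, S4′. -/
theorem EulerHalfNotRamNoInertSetAtFive_of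
    (hF : rank_eq_analyticRank_of_analyticRank_le_one ∧ exists_isAdmissibleZetaClass_of_imageContainsSL2)
    (hS1 : ∀ (W : WeierstrassCurve ℚ) [W.IsElliptic] [W.IsGloballyMinimal] (p : ℕ) [Fact p.Prime]
      [ContinuousSMul ℤ_[p] (W.tateModule p)],
      5 ≤ p → Surj W p → W.analyticRank = 1 →
      ∀ (h1 : W.mordellWeilRank = 1) (P : Fin W.mordellWeilRank → W.toAffine.Point),
        W.IsMordellWeilBasis P →
      ∀ (K : ZpExtension ℚ p) (hK : K.IsCyclotomic) (γ : absoluteGaloisGroup ℚ)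
        (I : IwasawaH1Data W p K γ) (z₀ : I.H), K.IsTopGenerator γ → IsAdmissibleZetaClass W p K hK I z₀ →
      ∀ t : ℚ_[p], HasLocPKummerLog W p (bottomClass W p K I z₀) t → t ≠ 0 →
      ∀ (m : ℕ) (Q₀ : (W.baseChange ℚ_[p]).toAffine.Point), addOrderOf Q₀ = p ^ m →
      ∀ Q : (W.baseChange ℚ_[p]).toAffine.Point, padicLogLocal W p Q ≠ 0 →
        (padicValNat p W.shaOrder : ℤ) + (logOmega W p (P (Fin.cast h1.symm 0))).valuation
            - (padicLogLocal W p Q).valuation + m ≤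
          t.valuation - (logOmega W p (P (Fin.cast h1.symm 0))).valuation)
    (hS1' : ∀ (W : WeierstrassCurve ℚ) [W.IsElliptic] [W.IsGloballyMinimal] (p : ℕ) [Fact p.Prime]
      [ContinuousSMul ℤ_[p] (W.tateModule p)],
      5 ≤ p → Surj W p → W.analyticRank = 1 → W.HasSplitMultiplicativeReductionAtPrime p →
      padicValNat p W.tamagawaProduct ≠ padicValNat p (padicValInt p W.minimalDiscriminantInt) →
      ∀ (h1 : W.mordellWeilRank = 1) (P : Fin W.mordellWeilRank → W.toAffine.Point),
        W.IsMordellWeilBasis P →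
      ∀ (K : ZpExtension ℚ p) (hK : K.IsCyclotomic) (γ : absoluteGaloisGroup ℚ)
        (I : IwasawaH1Data W p K γ) (z₀ : I.H), K.IsTopGenerator γ → IsAdmissibleZetaClass W p K hK I z₀ →
      ∀ t : ℚ_[p], HasLocPKummerLog W p (bottomClass W p K I z₀) t → t ≠ 0 →
      ∀ (m : ℕ) (Q₀ : (W.baseChange ℚ_[p]).toAffine.Point), addOrderOf Q₀ = p ^ m →
      ∀ Q : (W.baseChange ℚ_[p]).toAffine.Point, padicLogLocal W p Q ≠ 0 →
        (padicValNat p W.shaOrder : ℤ) + (logOmega W p (P (Fin.cast h1.symm 0))).valuation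
            - (padicLogLocal W p Q).valuation
            + (((padicValNat p W.tamagawaProduct : ℤ) - padicValNat p (padicValInt p W.minimalDiscriminantInt))
                + m) ≤
          t.valuation - (logOmega W p (P (Fin.cast h1.symm 0))).valuation)
    (hS2 : ∀ (W : WeierstrassCurve ℚ) [W.IsElliptic] [W.IsGloballyMinimal] (p : ℕ) [Fact p.Prime],
      5 ≤ p → W.HasSplitMultiplicativeReductionAtPrime p →
      ∃ (m : ℕ) (Q₀ Q : (W.baseChange ℚ_[p]).toAffine.Point), addOrderOf Q₀ = p ^ m ∧
        padicLogLocal W p Q ≠ 0 ∧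
        (padicLogLocal W p Q).valuation =
          1 - (padicValNat p (padicValInt p W.minimalDiscriminantInt) : ℤ) + m)
    (hS3 : ∀ (W : WeierstrassCurve ℚ) [W.IsElliptic] [W.IsGloballyMinimal] (p : ℕ) [Fact p.Prime]
      [ContinuousSMul ℤ_[p] (W.tateModule p)],
      ClassX11b W p → 5 ≤ p → Surj W p → W.HasSplitMultiplicativeReductionAtPrime p →
      ∀ (h1 : W.mordellWeilRank = 1) (P : Fin W.mordellWeilRank → W.toAffine.Point),
        W.IsMordellWeilBasis P →
      ∀ (K : ZpExtension ℚ p) (hK : K.IsCyclotomic) (γ : absoluteGaloisGroup ℚ)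
        (I : IwasawaH1Data W p K γ) (z₀ : I.H), K.IsTopGenerator γ → IsAdmissibleZetaClass W p K hK I z₀ →
      ∃ (q : ℚ) (t : ℚ_[p]), shaAn W = (q : ℂ) ∧ HasLocPKummerLog W p (bottomClass W p K I z₀) t ∧ t ≠ 0 ∧
        t.valuation - 2 * (logOmega W p (P (Fin.cast h1.symm 0))).valuation ≤
          padicValRat p q + padicValNat p W.tamagawaProduct - 2 * padicValNat p W.torsionOrder - 1)
    (hS4 : ∀ (W : WeierstrassCurve ℚ) [W.IsElliptic] [W.IsGloballyMinimal] (p : ℕ) [Fact p.Prime],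
      ClassX11b W p → 5 ≤ p → Surj W p → ¬ Ram W p → p ∣ W.tamagawaProduct →
      ¬ (∃ S : Finset ℕ, (∀ ℓ ∈ S, ∃ _ : Fact ℓ.Prime, Mult W ℓ) ∧ Even S.card ∧ p ∈ S ∧
          (∀ (ℓ : ℕ) [Fact ℓ.Prime], ℓ ∉ S → W.HasSplitMultiplicativeReductionAtPrime ℓ →
            ¬ p ∣ padicValInt ℓ W.minimalDiscriminantInt) ∧
          (¬ p ∣ padicValInt p W.minimalDiscriminantInt ∨
            ∃ R ⊆ S, S.card = 2 * R.card ∧ ∀ q ∈ R, q ≠ 2 ∧ ¬ p ∣ q - 1)) →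
      ¬ W.HasSplitMultiplicativeReductionAtPrime p →
      MissingUpperBoundAt W p) :
    EulerHalfNotRamNoInertSetAtFive := by
  intro W _ _ p _ hX h5 hSurj hnRam hTam hNoS
  by_cases hsplit : W.HasSplitMultiplicativeReductionAtPrime p
  · haveI : ContinuousSMul ℤ_[p] (W.tateModule p) := TateModule.continuousSMul_padicInt
    have hr1 : W.analyticRank = 1 := hX.1
    have hmw : W.mordellWeilRank = 1 := by
      have h := (hF.1 W (le_of_eq hr1)).1
      omega
    obtain ⟨P, hP⟩ := W.exists_isMordellWeilBasis_holds
    obtain ⟨K, hK, γ, I, z₀, hγ, hz⟩ := hF.2.exists_datum_of_hasSurjectiveModNGaloisRep W p h5 hSurj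
    obtain ⟨q, t, hq, ht, ht0, hC⟩ := hS3 W p hX h5 hSurj hsplit hmw P hP K hK γ I z₀ hγ hz
    obtain ⟨m, Q₀, Q, hQ₀, hQ0, hQv⟩ := hS2 W p h5 hsplit
    refine ⟨q, hq, ?_⟩
    by_cases hcc : padicValNat p W.tamagawaProduct = padicValNat p (padicValInt p W.minimalDiscriminantInt)
    · have hB := hS1 W p h5 hSurj hr1 hmw P hP K hK γ I z₀ hγ hz t ht ht0 m Q₀ hQ₀ Q hQ0
      have hcc' : (padicValNat p W.tamagawaProduct : ℤ) =
          (padicValNat p (padicValInt p W.minimalDiscriminantInt) : ℤ) := by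
        exact_mod_cast hcc
      exact sha_le_of_doorGraded _ _ _ _ _ _ _ _ _ hB hQv hC hcc' (by positivity)
    · have hB := hS1' W p h5 hSurj hr1 hsplit hcc hmw P hP K hK γ I z₀ hγ hz t ht ht0 m Q₀ hQ₀ Q hQ0
      exact sha_le_of_doorTwoGraded _ _ _ _ _ _ _ _ _ hB hQv hC (by positivity)
  · exact hS4 W p hX h5 hSurj hnRam hTam hNoS hsplit

/-- The same composition keyed by the stub NAMES (so that a skeleton registration — by the LEAD / pen only,
W-79 — would record exactly these six signatures). -/
theorem EulerHalfNotRamNoInertSetAtFive_of_stubs : EulerHalfNotRamNoInertSetAtFive :=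
  EulerHalfNotRamNoInertSetAtFive_of stub_printedFactsHeld stub_katoKolyvaginLogBoundLocalTorsion
    stub_katoKolyvaginLogBoundDefect stub_tateUniformisationLogMinimum stub_integralExcZeroValue
    stub_nonSplitResidual

end Summit.BirchSwinnertonDyer.BirchSwinnertonDyer.Cruxes.EulerHalfNotRamNoInertSetAtFive.KatoFframe

end
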